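import Summits.QuantumFields.YangMills.Theorems.BalabanUVNodesPortS1LZdetPiecesDefs
import Summits.QuantumFields.YangMills.Theorems.BalabanUVNodesPortS1LZdet63Local
import Summits.QuantumFields.YangMills.Theorems.BalabanUVNodesPortS1HalvesJacGlue

/-!
# NODE O port PT-A — THE GAUSSIAN BRACKET IS THE SUM OF ITS LOCALIZED PIECES ON THE GERM: under the P0-ℂ letter's germ clauses (P2)(P5), its localization (P4) read on the non-b₀ blocks, and
# `stub_G3C`'s resummed resolvent pieces (g1)+(x-continuity), `phiLZdet n B = Σ_{X ∈ 𝐃} lzdetPiece … X (recordPairJ … B)` EVENTUALLY at `B = 0` — the (f′) input of the v3.3 glue `stub_LZdetGlue`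
# (27930, line `pta_residueW`); [16] (61)∕(63) on the finite interval `[0, R]`, the constant `½ Tr 1·log R` cancelling in the difference «log det T(U_{k+1}) − log det T(1)»

Cell `ym-nodeO-ideate`, porter seat `ymgap-nodeO-port-PTA-1` (gen 7); `--supports stmt-QuantumFields-27930` (helper).  [16] = [Balaban1985UV3], [I] = [Balaban1987RG1].
By name: ✓`…LZdet63Local.logDet63_localized_at` (the pointwise identity, twice: at `U_{k+1}(W_B)` and at `1`), ✓`…HalvesJacGlue.eventually_phiLZdet_eq_logDet` (`phiLZdet = −½[log det T(B) − log det T(0)]` on the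
germ from ⁸'s TokE + TokP9-reg shapes), ✓`recordBgField_zero` ∕ `recordCurrent_zero` (the pair at `B = 0` is the unit pair), ✓`…LZdetPiecesDefs`.  The clause shapes are DEF-1 ed.23's (`P0CarrierClauses`,
(P2)(P5)) and this seat's `G3CPiecesAt` ((g1)); the support and Schur inputs are taken here on the NON-b₀ BLOCKS through a cube map `cube : NonB0Idx → (ℤ∕q)^4` (the wrapper derives them from (P4)).
* §1 `recordPairJ_zero` — `recordPairJ … 0 = unitCPair`; `nonB0Block_sum`, `map_ofReal_eq_sum_nonB0Block` ((P2) + (P4-sum) ⇒ `T(B).map ofReal = Σ_Y nonB0Block (TY n Y φ_B)`).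
* §2 ★★★ `eventually_phiLZdet_eq_sum_lzdetPiece`.

HONEST FRAMING.  A composition of landed pieces under DISPLAYED hypotheses (the P0-ℂ letter and G3C are inhabited NOWHERE); nothing of Bałaban asserted or proved; `stub_P0C` ∕ `stub_G3C` ∕ `stub_LZdetGlue` ∕
`stub_FE` OPEN; 27930 OPEN (stubs 2∕6 by name) · no claim; NODE O 0∕1; COUNT 8∕28 · K 1∕4 UNMOVED; finite `𝕋⁴_{L^K}` at fixed ε — NOT continuum ∕ OS ∕ Clay; **the Yang–Mills mass gap is NOT proved by any of
this.**  No `sorry`, no `def`, no `instance`; standard axioms.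
-/

noncomputable section

open scoped BigOperators Matrix.Norms.L2Operator Topology
open Finset

namespace Summit.QuantumFields.YangMills.Theorems.BalabanUVNodesPortS1

open Summit.QuantumFields.YangMills.Theorems.K0RecordFormatNames
open Literature.MathematicalPhysics.QuantumFieldTheory.Balaban1983to89
open Literature.MathematicalPhysics.QuantumFieldTheory.Balaban1983to89.Node00
open Literature.MathematicalPhysics.QuantumFieldTheory.Balaban1983to89.T4Continuum (T4Family)
open Literature.MathematicalPhysics.QuantumFieldTheory.Balaban1983to89.TreeLengthTorus (TPt IsTDom TDom torusTreeLen)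
open Literature.MathematicalPhysics.QuantumFieldTheory.Balaban1983to89.B12TreeDecay (K₀ kappa₀)
open _root_.Filter

variable (F : T4Family)

/-! ## §1  The pair at `B = 0`; the non-b₀ block of a sum -/

/-- **AT `B = 0` THE ROOTED PAIR IS THE UNIT PAIR**: `recordPairJ … 0 = (1, 0)` (`U_{k+1}(W_0) = 1` in the rooted gauge, its (1.8) current `0`). [cite: Balaban1987RG1, (2.3) p.265, (2.14) p.268] -/
theorem recordPairJ_zero (a₀ ε₂₉ : ℝ) (Mc k n : ℕ) :
    letI θ := thetaFill F a₀ ε₂₉; letI := θ.instVβ₁; letI := θ.instVβ₂; letI := θ.instιβ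
    recordPairJ F θ k (recordK₀ F Mc k + n) (0 : recordW F a₀ ε₂₉ k (recordK₀ F Mc k + n)) = unitCPair F (recordK₀ F Mc k + n) := by
  letI θ := thetaFill F a₀ ε₂₉; letI := θ.instVβ₁; letI := θ.instVβ₂; letI := θ.instιβ
  have hk := succ_le_m_add_K_recordK₀ F Mc k n
  show ((fun b => ((recordBgField F θ k (recordK₀ F Mc k + n) 0 b : SU 2) : MatA 2)), recordCurrent F θ k (recordK₀ F Mc k + n) 0) = unitCPair F (recordK₀ F Mc k + n)
  rw [recordBgField_zero F θ hk, recordCurrent_zero F θ hk]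
  rfl

/-- The non-b₀ block of a finite sum of kernels is the sum of the blocks. [folklore] -/
theorem nonB0Block_sum {ι : Type*} (s : Finset ι) (k K : ℕ) (A : ι → FluctIdx F k K → FluctIdx F k K → ℂ) :
    nonB0Block F k K (fun i j => ∑ Y ∈ s, A Y i j) = ∑ Y ∈ s, nonB0Block F k K (A Y) := by
  ext i j
  simp [nonB0Block, Matrix.sum_apply]

/-- **(P2) + (P4-sum) ON THE NON-b₀ BLOCK**: if `TC n φ i.1 j.1 = T i j` (real) on `NonB0Idx` and `TC n φ = Σ_Y TY n Y φ` entrywise, then `T.map ofReal = Σ_Y nonB0Block (TY n Y φ)`. [cite: Balaban1987RG1, (2.11)–(2.12) pp.267–268 (bookkeeping)] -/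
theorem map_ofReal_eq_sum_nonB0Block (Mc k K : ℕ) (T : Matrix (NonB0Idx F k K) (NonB0Idx F k K) ℝ)
    (TCφ : FluctIdx F k K → FluctIdx F k K → ℂ) (TYφ : (recordDomSys F Mc k K).Dom → FluctIdx F k K → FluctIdx F k K → ℂ)
    (h2 : ∀ i j : NonB0Idx F k K, TCφ i.1 j.1 = ((T i j : ℝ) : ℂ)) (hsum : ∀ i j, TCφ i j = ∑ Y, TYφ Y i j) :
    T.map (Complex.ofReal) = ∑ Y, nonB0Block F k K (TYφ Y) := by
  rw [← nonB0Block_sum]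
  ext i j
  simp only [Matrix.map_apply, nonB0Block, Matrix.of_apply]
  rw [← hsum, h2]

/-! ## §2  ★★★ The Gaussian bracket is the sum of its localized pieces on the germ -/

open scoped Classical in
/-- ★★★ **`phiLZdet n B = Σ_X lzdetPiece … X (recordPairJ … B)` EVENTUALLY AT `B = 0`.**  Hypotheses at volume `K₀ + n`: ⁸'s TokE and TokP9-reg shapes (for the germ `phiLZdet = −½[log det T(B) −
log det T(0)]`); the letter's (P2) (entrywise agreement of the non-b₀ block of `TC n φ_B` with `T(B) := recordPreckLoc … (portVkAx … B) …`), (P5) (`PosDef` + upper form bound `γ₁`), (P4-sum), (P4-supp)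
read through a cube map on `NonB0Idx`, operator-norm decay of the non-b₀ blocks of the pieces on the germ (`c₀ e^{−δ₀ d(Y)}`, from (P4-Schur)); `stub_G3C`'s (g1) on the germ and x-continuity of its pieces on
`[0, R]` on the germ; constants `κ₀(64, 8) ≤ δ₀∕2 − 1`, `2γ₁ ≤ R`, `2·c₀·(4·2⁴K₀(64,8))·e^{δ₀} ≤ R`. [cite: Balaban1985UV3, (61)∕(63) pp.271–272, (23)–(25) p.262; Balaban1987RG1, (2.11)–(2.14) pp.267–268, (1.7) p.261] -/
theorem eventually_phiLZdet_eq_sum_lzdetPiece (Mc : ℕ) (a₀ ε₂₉ : ℝ) (k n : ℕ) {ε₁ : ℝ} (hε₁ : 0 < ε₁)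
    (hTokE : ∀ V : GaugeField (F.P (recordK₀ F Mc k + n)) (k + 1) (SU 2), PlaqSmall ε₁ V →
      UkExists F 2 (recordK₀ F Mc k + n) (k + 1) a₀ V ∧ UniqueUkOrbit F 2 (recordK₀ F Mc k + n) (k + 1) a₀ V)
    (hP9 : letI θ := thetaFill F a₀ ε₂₉; letI := θ.instVβ₁; letI := θ.instVβ₂
      AnalyticAt ℝ (fun B : recordW F a₀ ε₂₉ k (recordK₀ F Mc k + n) => fun (b : PBond (F.P (recordK₀ F Mc k + n)) 0) (i i' : Fin 2) =>
        ((recordBgField F θ k (recordK₀ F Mc k + n) B b : SU 2) : Matrix (Fin 2) (Fin 2) ℂ) i i') 0)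
    (TC : Sect2.CPair (F.P (recordK₀ F Mc k + n)) (MatA 2) → FluctIdx F k (recordK₀ F Mc k + n) → FluctIdx F k (recordK₀ F Mc k + n) → ℂ)
    (TY : (recordDomSys F Mc k (recordK₀ F Mc k + n)).Dom → Sect2.CPair (F.P (recordK₀ F Mc k + n)) (MatA 2) →
        FluctIdx F k (recordK₀ F Mc k + n) → FluctIdx F k (recordK₀ F Mc k + n) → ℂ)
    (EG : ℝ → (recordDomSys F Mc k (recordK₀ F Mc k + n)).Dom → Sect2.CPair (F.P (recordK₀ F Mc k + n)) (MatA 2) → ℂ)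
    (cube : NonB0Idx F k (recordK₀ F Mc k + n) → TPt (F.P (recordK₀ F Mc k + n)).d (Sect2.domCount (F.P (recordK₀ F Mc k + n)) Mc (k + 1)))
    {γ₀ γ₁ c₀ δ₀ R : ℝ} (hγ₁ : 0 < γ₁) (hc₀ : 0 ≤ c₀)
    (hδ : kappa₀ (4 * 2 ^ (F.P (recordK₀ F Mc k + n)).d) (2 * (F.P (recordK₀ F Mc k + n)).d) ≤ δ₀ / 2 - 1) (hR : 2 * γ₁ ≤ R)
    (hRc : 2 * (c₀ * (4 * 2 ^ (F.P (recordK₀ F Mc k + n)).d * K₀ (4 * 2 ^ (F.P (recordK₀ F Mc k + n)).d) (2 * (F.P (recordK₀ F Mc k + n)).d)) * Real.exp δ₀) ≤ R)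
    -- (P2) on the germ
    (hP2 : letI θ := thetaFill F a₀ ε₂₉; letI := θ.instVβ₁; letI := θ.instVβ₂; letI := θ.instιβ
      ∀ᶠ B in 𝓝 (0 : recordW F a₀ ε₂₉ k (recordK₀ F Mc k + n)), ∀ i j : NonB0Idx F k (recordK₀ F Mc k + n),
        TC (recordPairJ F θ k (recordK₀ F Mc k + n) B) i.1 j.1 =
          ((recordPreckLoc F k (recordK₀ F Mc k + n) a₀ (portVkAx F a₀ ε₂₉ k (recordK₀ F Mc k + n) B)
            (hopLinGraph F k (recordK₀ F Mc k + n) (portVkAx F a₀ ε₂₉ k (recordK₀ F Mc k + n) B)) i j : ℝ) : ℂ))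
    -- (P5) on the germ
    (hP5 : letI θ := thetaFill F a₀ ε₂₉; letI := θ.instVβ₁; letI := θ.instVβ₂; letI := θ.instιβ
      ∀ᶠ B in 𝓝 (0 : recordW F a₀ ε₂₉ k (recordK₀ F Mc k + n)),
        (recordPreckLoc F k (recordK₀ F Mc k + n) a₀ (portVkAx F a₀ ε₂₉ k (recordK₀ F Mc k + n) B)
            (hopLinGraph F k (recordK₀ F Mc k + n) (portVkAx F a₀ ε₂₉ k (recordK₀ F Mc k + n) B))).PosDef ∧
        ∀ v : NonB0Idx F k (recordK₀ F Mc k + n) → ℝ,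
          γ₀ * dotProduct v v ≤
              dotProduct v (Matrix.mulVec (recordPreckLoc F k (recordK₀ F Mc k + n) a₀ (portVkAx F a₀ ε₂₉ k (recordK₀ F Mc k + n) B)
                (hopLinGraph F k (recordK₀ F Mc k + n) (portVkAx F a₀ ε₂₉ k (recordK₀ F Mc k + n) B))) v) ∧
            dotProduct v (Matrix.mulVec (recordPreckLoc F k (recordK₀ F Mc k + n) a₀ (portVkAx F a₀ ε₂₉ k (recordK₀ F Mc k + n) B)
                (hopLinGraph F k (recordK₀ F Mc k + n) (portVkAx F a₀ ε₂₉ k (recordK₀ F Mc k + n) B))) v) ≤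
              γ₁ * dotProduct v v)
    -- (P4-sum) everywhere; (P4-supp) on the non-b₀ blocks through the cube map
    (hsum : ∀ φ i j, TC φ i j = ∑ Y, TY Y φ i j)
    (hsupp : ∀ Y φ (s s' : NonB0Idx F k (recordK₀ F Mc k + n)),
      (cube s ∉ (Y.1 : Finset (TPt (F.P (recordK₀ F Mc k + n)).d (Sect2.domCount (F.P (recordK₀ F Mc k + n)) Mc (k + 1)))) ∨
        cube s' ∉ (Y.1 : Finset (TPt (F.P (recordK₀ F Mc k + n)).d (Sect2.domCount (F.P (recordK₀ F Mc k + n)) Mc (k + 1))))) → TY Y φ s.1 s'.1 = 0)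
    -- operator-norm decay of the non-b₀ blocks on the germ (from (P4-Schur))
    (hSchur : letI θ := thetaFill F a₀ ε₂₉; letI := θ.instVβ₁; letI := θ.instVβ₂; letI := θ.instιβ
      ∀ᶠ B in 𝓝 (0 : recordW F a₀ ε₂₉ k (recordK₀ F Mc k + n)), ∀ Y,
        ‖nonB0Block F k (recordK₀ F Mc k + n) (TY Y (recordPairJ F θ k (recordK₀ F Mc k + n) B))‖ ≤
          c₀ * Real.exp (-(δ₀ * torusTreeLen (Y.1 : Finset (TPt (F.P (recordK₀ F Mc k + n)).d (Sect2.domCount (F.P (recordK₀ F Mc k + n)) Mc (k + 1)))))))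
    -- (g1) and x-continuity on the germ
    (hg1 : letI θ := thetaFill F a₀ ε₂₉; letI := θ.instVβ₁; letI := θ.instVβ₂; letI := θ.instιβ
      ∀ᶠ B in 𝓝 (0 : recordW F a₀ ε₂₉ k (recordK₀ F Mc k + n)), ∀ x : ℝ, 0 ≤ x →
        ∑ X, EG x X (recordPairJ F θ k (recordK₀ F Mc k + n) B) =
          (((x : ℂ) • (1 : Matrix (NonB0Idx F k (recordK₀ F Mc k + n)) (NonB0Idx F k (recordK₀ F Mc k + n)) ℂ) +
            nonB0Block F k (recordK₀ F Mc k + n) (TC (recordPairJ F θ k (recordK₀ F Mc k + n) B)))⁻¹).trace)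
    (hcont : letI θ := thetaFill F a₀ ε₂₉; letI := θ.instVβ₁; letI := θ.instVβ₂; letI := θ.instιβ
      ∀ᶠ B in 𝓝 (0 : recordW F a₀ ε₂₉ k (recordK₀ F Mc k + n)), ∀ X,
        ContinuousOn (fun x : ℝ => EG x X (recordPairJ F θ k (recordK₀ F Mc k + n) B)) (Set.Icc 0 R)) :
    letI θ := thetaFill F a₀ ε₂₉; letI := θ.instVβ₁; letI := θ.instVβ₂; letI := θ.instιβ
    ∀ᶠ B in 𝓝 (0 : recordW F a₀ ε₂₉ k (recordK₀ F Mc k + n)),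
      phiLZdet F Mc a₀ ε₂₉ k n B = ∑ X, lzdetPiece F Mc k (recordK₀ F Mc k + n) TY EG R X (recordPairJ F θ k (recordK₀ F Mc k + n) B) := by
  letI θ := thetaFill F a₀ ε₂₉; letI := θ.instVβ₁; letI := θ.instVβ₂; letI := θ.instιβ
  -- the data AT B = 0 (every germ clause holds at the base point)
  have hP2₀ := hP2.self_of_nhds
  have hP5₀ := hP5.self_of_nhds
  have hSchur₀ := hSchur.self_of_nhds
  have hg1₀ := hg1.self_of_nhds
  have hcont₀ := hcont.self_of_nhds
  have hpair₀ : recordPairJ F θ k (recordK₀ F Mc k + n) (0 : recordW F a₀ ε₂₉ k (recordK₀ F Mc k + n)) = unitCPair F (recordK₀ F Mc k + n) := recordPairJ_zero F a₀ ε₂₉ Mc k n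
  -- the pointwise identity at a configuration with the germ data
  have key : ∀ (φ : Sect2.CPair (F.P (recordK₀ F Mc k + n)) (MatA 2)) (T : Matrix (NonB0Idx F k (recordK₀ F Mc k + n)) (NonB0Idx F k (recordK₀ F Mc k + n)) ℝ), T.PosDef →
      (∀ v, dotProduct v (T.mulVec v) ≤ γ₁ * dotProduct v v) →
      (∀ i j : NonB0Idx F k (recordK₀ F Mc k + n), TC φ i.1 j.1 = ((T i j : ℝ) : ℂ)) →
      (∀ Y, ‖nonB0Block F k (recordK₀ F Mc k + n) (TY Y φ)‖ ≤ c₀ * Real.exp (-(δ₀ * torusTreeLen (Y.1 : Finset (TPt (F.P (recordK₀ F Mc k + n)).d (Sect2.domCount (F.P (recordK₀ F Mc k + n)) Mc (k + 1))))))) →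
      (∀ x : ℝ, 0 ≤ x → ∑ X, EG x X φ = (((x : ℂ) • (1 : Matrix (NonB0Idx F k (recordK₀ F Mc k + n)) (NonB0Idx F k (recordK₀ F Mc k + n)) ℂ) + nonB0Block F k (recordK₀ F Mc k + n) (TC φ))⁻¹).trace) →
      (∀ X, ContinuousOn (fun x : ℝ => EG x X φ) (Set.Icc 0 R)) →
      (((-(1 / 2) * Real.log T.det + (1 / 2) * (Fintype.card (NonB0Idx F k (recordK₀ F Mc k + n)) : ℝ) * Real.log R : ℝ)) : ℂ)
        = ∑ X, lzdetGPiece F Mc k (recordK₀ F Mc k + n) TY EG R X φ := by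
    intro φ T hT hform h2 hS hg hc
    have hTC : T.map (Complex.ofReal) = ∑ Y, nonB0Block F k (recordK₀ F Mc k + n) (TY Y φ) :=
      map_ofReal_eq_sum_nonB0Block F Mc k (recordK₀ F Mc k + n) T (TC φ) (fun Y => TY Y φ) h2 (hsum φ)
    have hblk : nonB0Block F k (recordK₀ F Mc k + n) (TC φ) = ∑ Y, nonB0Block F k (recordK₀ F Mc k + n) (TY Y φ) := by
      rw [← nonB0Block_sum]; congr 1; funext i j; exact hsum φ i j
    have hg' : ∀ x : ℝ, 0 ≤ x → ∑ X, EG x X φ = (((x : ℂ) • (1 : Matrix (NonB0Idx F k (recordK₀ F Mc k + n)) (NonB0Idx F k (recordK₀ F Mc k + n)) ℂ) + ∑ Y, nonB0Block F k (recordK₀ F Mc k + n) (TY Y φ))⁻¹).trace := by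
      intro x hx; rw [hg x hx, hblk]
    exact logDet63_localized_at (S := NonB0Idx F k (recordK₀ F Mc k + n)) cube (fun Y => nonB0Block F k (recordK₀ F Mc k + n) (TY Y φ)) (fun x X => EG x X φ) hT hγ₁ hform hR hTC
      (fun Y s s' h => by simp only [nonB0Block, Matrix.of_apply]; exact hsupp Y φ s s' h) hc₀ hδ hS hRc hg' hc
  have hdet := eventually_phiLZdet_eq_logDet F Mc a₀ ε₂₉ k n hε₁ hTokE hP9
  rw [show (thetaFill F a₀ ε₂₉).εbg = a₀ from rfl] at hdet
  filter_upwards [hdet, hP2, hP5, hSchur, hg1, hcont] with B hdetB h2 h5 hS hg hc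
  have hB := key _ _ h5.1 (fun v => (h5.2 v).2) h2 hS hg hc
  have h0 := key _ _ hP5₀.1 (fun v => (hP5₀.2 v).2) hP2₀ hSchur₀ hg1₀ hcont₀
  rw [hpair₀] at h0
  rw [hdetB h5.1 hP5₀.1]
  -- −½(log det T(B) − log det T(0)) = [−½ log det T(B) + c] − [−½ log det T(0) + c]
  have hsplit : ∀ (A A₀ c : ℝ), ((-(1 / 2 : ℝ) * (A - A₀) : ℝ) : ℂ) = (((-(1 / 2) * A + c : ℝ)) : ℂ) - (((-(1 / 2) * A₀ + c : ℝ)) : ℂ) := by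
    intro A A₀ c; push_cast; ring
  rw [hsplit _ _ ((1 / 2) * (Fintype.card (NonB0Idx F k (recordK₀ F Mc k + n)) : ℝ) * Real.log R), hB, h0, ← sum_sub_distrib]
  simp only [lzdetPiece]

end Summit.QuantumFields.YangMills.Theorems.BalabanUVNodesPortS1

end
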